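import Summits.BirchSwinnertonDyer.BirchSwinnertonDyer.Theorems.ErratumRoadFiveRegCertKernelFiveLog
import HarnessLib

/-!
# Route `ErratumRoadFive` (rung K2, `p ≥ 5`), crux `RamNoErratumDataAtFive` (item stmt-BirchSwinnertonDyer-19624, REST‴):
# the REG5CERT kernel evaluator at certificate DEPTH ONE (`‖z(Q)‖₅ = 5⁻¹`) — `5`-adic series estimates for `ch`, the Tate
# sigma product and the formal logarithm at the coarser radius; the integer model read in `ℚ₅`
# (cell `bsd-stepL`, seat `bsd-stepL-rest-p2` g7; `--supports stmt-BirchSwinnertonDyer-19624`)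

HONEST FRAMING: BSD is not proved by any of this; nothing here closes the crux; Schneider's non-degeneracy conjecture
(barrier `Literature.Barriers.BirchSwinnertonDyer.PAdicHeightNondegeneracy`) is asserted NOWHERE. Depth-one twins of seat
reg3-eng's depth-two (`‖z‖₅ ≤ 5⁻²`, `‖w‖₅ ≤ 5⁻⁴`) estimates `KernelCertFive.norm_coshOfSq_sub_le`,
`…norm_tateSigmaSq_coshOfSq_sub_le`, `…norm_padicFormalLog_sub_quadratic_le` (`Theorems/ErratumRoadFiveRegCertKernelFive{Series,Log}`),
used by the generic first-order checker `Theorems/ErratumRoadFiveRegCertKernelFiveChecker.lean` (same seat) at the branch-(D)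
witnesses of crux 19624 whose first admissible multiple of the generator has `‖z‖₅ = 5⁻¹` (D1, D2): there every depth-two
admissible point is `5·Q₁` with `v₅(h(5Q₁)) = v₅(h(Q₁)) + 2 ≥ 3`, beyond a first-order depth-two certificate, while the
depth-one certificate decides the generic case `v₅(h(Q₁)) = 1`. Theorems only (0 defs, 0 facts):

* §1 `norm_coshOfSq_sub_le_depthOne` — `‖ch(w) − (1 + w/2)‖₅ ≤ 5⁻⁴` for `‖w‖₅ ≤ 5⁻²`; `norm_tateSigmaSq_coshOfSq_sub_le_depthOne`
  — `‖σ_q²(ch(w)) − w‖₅ ≤ 5⁻⁴` for `‖q‖₅ < 1`, `‖w‖₅ ≤ 5⁻²` (so the uniformisation scale `C²` still cancels at first order);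
* §2 `norm_padicFormalLog_sub_quadratic_le_depthOne` — `‖log_Ŵ(z) − (z + a₁z²/2)‖₅ ≤ 5⁻³` for `‖z‖₅ ≤ 5⁻¹`, `Ŵ` `5`-integral;
* §3 the integer model `⟨a₁,…,a₆⟩` read in `ℚ₅` (`a₁`, `c₄`, `c₆`) and `‖C²‖₅ = 1` for the uniformisation scale when `5 ∤ c₄c₆`
  (generic form of reg3-eng's `Rung5595f1.norm_uniformisationScaleSq_eq_one`).

`Fact (Nat.Prime 5)` is a section hypothesis as in the depth-two files. References: [SteinWuthrich2013] §4.2;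
[SilvermanAEC2009] IV.6.3–6.4; [Iwasawa1972PadicL] §4.4.
-/

open scoped Classical

open Filter Topology PowerSeries IsUltrametricDist WeierstrassCurve Literature.NumberTheory.EllipticCurves
  Literature.NumberTheory.EllipticCurves.SteinWuthrich2013
  Summit.BirchSwinnertonDyer.Rank1Residual.X11b.RegMult.Rung62310y1

namespace Summit.BirchSwinnertonDyer.Rank1Residual.X11b.RegMult.KernelCertFive

variable [Fact (Nat.Prime 5)]

/-! ### §0 Plumbing in `ℚ₅` -/

/-- In `ℚ₅`, `‖x‖ < 1 ⇒ ‖x‖ ≤ 5⁻¹`. [folklore] -/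
private theorem norm_le_fifth_of_norm_lt_one₀ {x : ℚ_[5]} (hx : ‖x‖ < 1) : ‖x‖ ≤ 1 / 5 := by
  have h := norm_le_inv_of_norm_lt_one (p := 5) hx
  rw [one_div]; exact_mod_cast h

/-! ### §1 Depth-one series estimates: `ch` and the Tate sigma product at `‖w‖₅ ≤ 5⁻²` -/

/-- **Legendre at `p = 5`**: `‖1/(2n)!‖₅ ≤ 5ⁿ`. [cite: SilvermanAEC2009, IV.6.3] -/
private theorem norm_inv_factorial_le₀ (n : ℕ) : ‖(((2 * n).factorial : ℕ) : ℚ_[5])⁻¹‖ ≤ (5 : ℝ) ^ n := by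
  have hf : ((2 * n).factorial : ℕ) ≠ 0 := Nat.factorial_ne_zero _
  rw [norm_inv, Padic.norm_eq_zpow_neg_valuation (by exact_mod_cast hf), Padic.valuation_natCast, zpow_neg,
    inv_inv, zpow_natCast]
  have hv : padicValNat 5 (2 * n).factorial ≤ n := by
    have h := sub_one_mul_padicValNat_factorial (p := 5) (2 * n)
    have hs : (5 - 1) * padicValNat 5 (2 * n).factorial ≤ 2 * n := by rw [h]; exact Nat.sub_le _ _
    omega
  exact_mod_cast Nat.pow_le_pow_right (by norm_num) hv

/-- The general term of `coshOfSq w` has norm `≤ 5^{−n}` for `‖w‖₅ ≤ 5⁻²`. [folklore] -/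
private theorem norm_coshOfSq_term_le₁ {w : ℚ_[5]} (hw : ‖w‖ ≤ 1 / 25) (n : ℕ) :
    ‖w ^ n / (((2 * n).factorial : ℕ) : ℚ_[5])‖ ≤ (1 / 5 : ℝ) ^ n := by
  rw [div_eq_mul_inv, norm_mul, norm_pow]
  calc ‖w‖ ^ n * ‖(((2 * n).factorial : ℕ) : ℚ_[5])⁻¹‖ ≤ (1 / 25 : ℝ) ^ n * (5 : ℝ) ^ n := by
        gcongr; exact norm_inv_factorial_le₀ n
    _ = (1 / 5 : ℝ) ^ n := by rw [← mul_pow]; norm_num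

/-- `coshOfSq` converges at `‖w‖₅ ≤ 5⁻²` (geometric majorant `5⁻ⁿ`). [folklore] -/
theorem summable_coshOfSq_term_depthOne {w : ℚ_[5]} (hw : ‖w‖ ≤ 1 / 25) :
    Summable fun n : ℕ ↦ w ^ n / (((2 * n).factorial : ℕ) : ℚ_[5]) := by
  refine Summable.of_norm_bounded (summable_geometric_of_lt_one (by norm_num) (by norm_num : (1 / 5 : ℝ) < 1)) ?_
  intro n; exact norm_coshOfSq_term_le₁ hw n

/-- **`‖ch(w) − (1 + w/2)‖₅ ≤ 5⁻⁴` for `‖w‖₅ ≤ 5⁻²`**: `‖w²/24‖ = ‖w‖² ≤ 5⁻⁴`, `‖w³/720‖ = 5‖w‖³ ≤ 5⁻⁵`, every later term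
`≤ 5⁻ⁿ ≤ 5⁻⁴`. [folklore] -/
theorem norm_coshOfSq_sub_le_depthOne {w : ℚ_[5]} (hw : ‖w‖ ≤ 1 / 25) :
    ‖coshOfSq w - (1 + w / 2)‖ ≤ 1 / 5 ^ 4 := by
  have hs := summable_coshOfSq_term_depthOne hw
  have hsplit := hs.sum_add_tsum_nat_add 4
  have hdef : coshOfSq w = ∑' n : ℕ, w ^ n / (((2 * n).factorial : ℕ) : ℚ_[5]) := by rw [coshOfSq]
  rw [hdef, ← hsplit]
  simp only [Finset.sum_range_succ, Finset.sum_range_zero, zero_add, pow_zero, Nat.mul_zero, Nat.factorial_zero,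
    Nat.cast_one, div_one, pow_one]
  have h2 : (((2 * 1).factorial : ℕ) : ℚ_[5]) = 2 := by norm_num [Nat.factorial]
  have h24 : (((2 * 2).factorial : ℕ) : ℚ_[5]) = 24 := by norm_num [Nat.factorial]
  have h720 : (((2 * 3).factorial : ℕ) : ℚ_[5]) = 720 := by norm_num [Nat.factorial]
  rw [h2, h24, h720]
  have hring : 1 + w / 2 + w ^ 2 / 24 + w ^ 3 / 720 +
      ∑' n : ℕ, w ^ (n + 4) / (((2 * (n + 4)).factorial : ℕ) : ℚ_[5]) - (1 + w / 2) =
      w ^ 2 / 24 + (w ^ 3 / 720 + ∑' n : ℕ, w ^ (n + 4) / (((2 * (n + 4)).factorial : ℕ) : ℚ_[5])) := by ring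
  rw [hring]
  refine (IsUltrametricDist.norm_add_le_max _ _).trans (max_le ?_ ?_)
  · have h24n : ‖((24 : ℚ_[5]))⁻¹‖ = 1 := by
      rw [norm_inv, show (24 : ℚ_[5]) = ((24 : ℤ) : ℚ_[5]) by norm_cast, norm_intCast_eq_one_of_not_dvd (by decide),
        inv_one]
    rw [div_eq_mul_inv, norm_mul, norm_pow, h24n, mul_one]
    calc ‖w‖ ^ 2 ≤ (1 / 25 : ℝ) ^ 2 := by gcongr
      _ = 1 / 5 ^ 4 := by norm_num
  refine (IsUltrametricDist.norm_add_le_max _ _).trans (max_le ?_ ?_)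
  · have h720n : ‖((720 : ℚ_[5]))⁻¹‖ = 5 := by
      rw [norm_inv, show (720 : ℚ_[5]) = ((720 : ℕ) : ℚ_[5]) by norm_cast,
        Padic.norm_eq_zpow_neg_valuation (by norm_num), Padic.valuation_natCast]
      have : padicValNat 5 720 = 1 := by
        have h1 : 1 ≤ padicValNat 5 720 := (padicValNat_dvd_iff_le (by norm_num)).mp (by norm_num)
        have h2 : ¬ 2 ≤ padicValNat 5 720 := fun h => by
          have := (padicValNat_dvd_iff_le (p := 5) (n := 2) (by norm_num : (720 : ℕ) ≠ 0)).mpr h; norm_num at this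
        omega
      rw [this]; norm_num
    rw [div_eq_mul_inv, norm_mul, norm_pow, h720n]
    calc ‖w‖ ^ 3 * 5 ≤ (1 / 25 : ℝ) ^ 3 * 5 := by gcongr
      _ ≤ 1 / 5 ^ 4 := by norm_num
  · refine IsUltrametricDist.norm_tsum_le_of_forall_le_of_nonneg (by norm_num) fun n ↦ ?_
    refine (norm_coshOfSq_term_le₁ hw (n + 4)).trans ?_
    calc (1 / 5 : ℝ) ^ (n + 4) = (1 / 5) ^ n * (1 / 5) ^ 4 := by rw [pow_add]
      _ ≤ 1 * (1 / 5) ^ 4 := by gcongr; exact pow_le_one₀ (by norm_num) (by norm_num)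
      _ ≤ 1 / 5 ^ 4 := by norm_num

/-- Corollaries at `‖w‖₅ ≤ 5⁻²`: `‖ch(w) − 1‖₅ ≤ 5⁻²` and `‖ch(w)‖₅ ≤ 1`. [folklore] -/
theorem norm_coshOfSq_sub_one_le_depthOne {w : ℚ_[5]} (hw : ‖w‖ ≤ 1 / 25) :
    ‖coshOfSq w - 1‖ ≤ 1 / 25 ∧ ‖coshOfSq w‖ ≤ 1 := by
  have h := norm_coshOfSq_sub_le_depthOne hw
  have hw2 : ‖w / 2‖ ≤ 1 / 25 := by rw [div_eq_mul_inv, norm_mul, norm_inv_two₅, mul_one]; exact hw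
  have h1 : ‖coshOfSq w - 1‖ ≤ 1 / 25 := by
    have : coshOfSq w - 1 = (coshOfSq w - (1 + w / 2)) + w / 2 := by ring
    rw [this]
    refine (IsUltrametricDist.norm_add_le_max _ _).trans (max_le (h.trans (by norm_num)) hw2)
  refine ⟨h1, ?_⟩
  have : coshOfSq w = (coshOfSq w - 1) + 1 := by ring
  rw [this]
  exact (IsUltrametricDist.norm_add_le_max _ _).trans (max_le (h1.trans (by norm_num)) (by rw [norm_one]))

/-- **`σ_q²(ch(w)) = w + O(5⁻⁴)` at depth one**: for `‖q‖₅ < 1` and `‖w‖₅ ≤ 5⁻²`, `‖tateSigmaSq q (coshOfSq w) − w‖₅ ≤ 5⁻⁴`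
(`σ² = 2(c − 1)·Π` with `‖2(c − 1) − w‖ ≤ 5⁻⁴`, `‖Π − 1‖ ≤ 5⁻¹·5⁻²`, `‖w‖ ≤ 5⁻²`). [cite: SteinWuthrich2013, §4.2] -/
theorem norm_tateSigmaSq_coshOfSq_sub_le_depthOne {q w : ℚ_[5]} (hq : ‖q‖ < 1) (hw : ‖w‖ ≤ 1 / 25) :
    ‖tateSigmaSq q (coshOfSq w) - w‖ ≤ 1 / 5 ^ 4 := by
  set c := coshOfSq w with hc
  obtain ⟨hc1, hcle⟩ := norm_coshOfSq_sub_one_le_depthOne hw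
  have hch := norm_coshOfSq_sub_le_depthOne hw
  have hq5 : ‖q‖ ≤ 1 / 5 := norm_le_fifth_of_norm_lt_one₀ hq
  set P := ∏' n : ℕ, (1 - 2 * q ^ (n + 1) * c + q ^ (2 * (n + 1))) ^ 2 / (1 - q ^ (n + 1)) ^ 4 with hP
  have hP1 : ‖P - 1‖ ≤ 1 / 5 ^ 3 := by
    refine (norm_tprod_tateSigmaSq_factor_sub_one_le hq hcle).trans ?_
    calc ‖q‖ * ‖c - 1‖ ≤ 1 / 5 * (1 / 25) := by gcongr
      _ = 1 / 5 ^ 3 := by norm_num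
  have hPle : ‖P‖ ≤ 1 := by
    have : P = (P - 1) + 1 := by ring
    rw [this]
    exact (IsUltrametricDist.norm_add_le_max _ _).trans (max_le (hP1.trans (by norm_num)) (by rw [norm_one]))
  have hdef : tateSigmaSq q c = 2 * (c - 1) * P := by rw [tateSigmaSq]
  have hsplit : tateSigmaSq q c - w = (2 * (c - (1 + w / 2))) * P + w * (P - 1) := by rw [hdef]; ring
  rw [hsplit]
  refine (IsUltrametricDist.norm_add_le_max _ _).trans (max_le ?_ ?_)
  · rw [norm_mul, norm_mul]
    have h2 : ‖(2 : ℚ_[5])‖ ≤ 1 := by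
      rw [show (2 : ℚ_[5]) = ((2 : ℤ) : ℚ_[5]) by norm_cast]; exact Padic.norm_int_le_one _
    calc ‖(2 : ℚ_[5])‖ * ‖c - (1 + w / 2)‖ * ‖P‖ ≤ 1 * (1 / 5 ^ 4) * 1 := by gcongr
      _ = 1 / 5 ^ 4 := by norm_num
  · rw [norm_mul]
    calc ‖w‖ * ‖P - 1‖ ≤ 1 / 25 * (1 / 5 ^ 3) := by gcongr
      _ ≤ 1 / 5 ^ 4 := by norm_num

/-! ### §2 Depth one: `log_Ŵ(z) = z + (a₁/2)z² + O(5⁻³)` for `‖z‖₅ ≤ 5⁻¹` -/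

section Padic

variable (V : WeierstrassCurve ℚ_[5]) [V.IsIntegral ℤ_[5]]

omit [Fact (Nat.Prime 5)] in
/-- `5³·m ≤ 5ᵐ` for `m ≥ 5`. [folklore] -/
private theorem pow_three_mul_le_pow {m : ℕ} (hm : 5 ≤ m) : 5 ^ 3 * m ≤ 5 ^ m := by
  induction m with
  | zero => omega
  | succ k ih =>
    rcases Nat.lt_or_ge k 5 with hk | hk
    · obtain rfl : k = 4 := by omega
      norm_num
    · have h6 : 5 ^ 3 ≤ 5 ^ k := Nat.pow_le_pow_right (by norm_num) (by omega)
      calc 5 ^ 3 * (k + 1) = 5 ^ 3 * k + 5 ^ 3 := by ring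
        _ ≤ 5 ^ k + 5 ^ k := Nat.add_le_add (ih hk) h6
        _ ≤ 5 ^ (k + 1) := by rw [pow_succ]; omega

/-- The terms of degree `≥ 3` of `log_Ŵ(z)` have norm `≤ 5⁻³` for `‖z‖₅ ≤ 5⁻¹` (`n = 3, 4` are `5`-adic units, and
`‖1/n‖₅ ≤ n ≤ 5ⁿ/5³` for `n ≥ 5`). [cite: SilvermanAEC2009, IV.6.3] -/
private theorem norm_formalLog_term_le_depthOne {z : ℚ_[5]} (hz : ‖z‖ ≤ 1 / 5) (n : ℕ) :
    ‖coeff (n + 3) V.formalLog * z ^ (n + 3)‖ ≤ 1 / 5 ^ 3 := by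
  rw [norm_mul, norm_pow]
  have hc := (norm_coeff_formalLog_le_norm_inv V) (n + 1)
  rw [show n + 1 + 2 = n + 3 by ring] at hc
  have hzn : ‖z‖ ^ (n + 3) ≤ (1 / 5 : ℝ) ^ (n + 3) := by gcongr
  rcases Nat.lt_or_ge n 2 with hn | hn
  · have hunit : ‖(((n + 3 : ℕ) : ℚ_[5]))⁻¹‖ = 1 := by
      rw [norm_inv, Padic.norm_eq_zpow_neg_valuation (by exact_mod_cast (show (n + 3 : ℕ) ≠ 0 by omega)),
        Padic.valuation_natCast,
        padicValNat.eq_zero_of_not_dvd (by interval_cases n <;> norm_num)]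
      simp
    calc ‖coeff (n + 3) V.formalLog‖ * ‖z‖ ^ (n + 3) ≤ 1 * (1 / 5 : ℝ) ^ (n + 3) := by
          gcongr; exact hc.trans hunit.le
      _ ≤ 1 * (1 / 5 : ℝ) ^ 3 :=
          mul_le_mul_of_nonneg_left (pow_le_pow_of_le_one (by norm_num) (by norm_num) (by omega)) (by norm_num)
      _ = 1 / 5 ^ 3 := by norm_num
  · have hm : ‖(((n + 3 : ℕ) : ℚ_[5]))⁻¹‖ ≤ ((n + 3 : ℕ) : ℝ) := padic_norm_inv_natCast_le (n + 3)
    have hpow := pow_three_mul_le_pow (show 5 ≤ n + 3 by omega)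
    have hpow' : ((5 : ℝ) ^ 3) * ((n + 3 : ℕ) : ℝ) ≤ (5 : ℝ) ^ (n + 3) := by exact_mod_cast hpow
    calc ‖coeff (n + 3) V.formalLog‖ * ‖z‖ ^ (n + 3) ≤ ((n + 3 : ℕ) : ℝ) * (1 / 5 : ℝ) ^ (n + 3) := by
          gcongr; exact hc.trans hm
      _ = ((n + 3 : ℕ) : ℝ) / (5 : ℝ) ^ (n + 3) := by rw [one_div, inv_pow]; ring
      _ ≤ 1 / 5 ^ 3 := by
          rw [div_le_div_iff₀ (by positivity) (by norm_num)]
          linarith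

/-- **`log_Ŵ(z) = z + (a₁/2)z² + O(5⁻³)` on `‖z‖₅ ≤ 5⁻¹`** for a `5`-integral equation over `ℚ₅`. [cite: SilvermanAEC2009, IV.6.4] -/
theorem norm_padicFormalLog_sub_quadratic_le_depthOne {z : ℚ_[5]} (hz : ‖z‖ ≤ 1 / 5) :
    ‖V.padicFormalLog z - (z + (2 : ℚ_[5])⁻¹ * V.a₁ * z ^ 2)‖ ≤ 1 / 5 ^ 3 := by
  have hs := V.summable_formalLog_of_isIntegral z (hz.trans_lt (by norm_num))
  have hsplit := hs.sum_add_tsum_nat_add 3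
  have h0 : coeff 0 V.formalLog = 0 := by rw [coeff_zero_eq_constantCoeff]; exact V.constantCoeff_formalLog
  have h2 : coeff 2 V.formalLog = (2 : ℚ_[5])⁻¹ * V.a₁ := by
    rw [(coeff_two_formalLog V), eq_ratCast]; push_cast; ring
  have hthree : ∑ i ∈ Finset.range 3, coeff i V.formalLog * z ^ i = z + (2 : ℚ_[5])⁻¹ * V.a₁ * z ^ 2 := by
    simp only [Finset.sum_range_succ, Finset.sum_range_zero, h0, V.coeff_one_formalLog, h2]
    ring
  rw [WeierstrassCurve.padicFormalLog, ← hsplit, hthree, add_sub_cancel_left]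
  exact IsUltrametricDist.norm_tsum_le_of_forall_le_of_nonneg (by norm_num) fun n ↦
    (norm_formalLog_term_le_depthOne V) hz n

end Padic

omit [Fact (Nat.Prime 5)] in
/-- `5 ∤ n ⇒ 5 ∤ n²` for an integer `n`. [folklore] -/
theorem not_five_dvd_sq {n : ℤ} (h : ¬ (5 : ℤ) ∣ n) : ¬ (5 : ℤ) ∣ n ^ 2 := fun h2 =>
  h ((Int.prime_iff_natAbs_prime.mpr (by norm_num)).dvd_of_dvd_pow h2)

/-! ### §3 The integer model read in `ℚ₅`; the uniformisation scale is a unit when `5 ∤ c₄c₆` -/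

section Model

variable (W : WeierstrassCurve ℚ) {a₁ a₂ a₃ a₄ a₆ : ℤ} (hW : W = ⟨a₁, a₂, a₃, a₄, a₆⟩)
include hW

/-- `a₁(W ⊗ ℚ₅) = a₁`. [folklore] -/
theorem baseChange_a₁_eq : (W.baseChange ℚ_[5]).a₁ = a₁ := by
  subst hW; rw [WeierstrassCurve.baseChange, WeierstrassCurve.map_a₁]; simp

/-- `c₄(W ⊗ ℚ₅) = b₂² − 24b₄` as an integer. [folklore] -/
theorem baseChange_c₄_eq {c4 : ℤ} (hc4 : c4 = (a₁ ^ 2 + 4 * a₂) ^ 2 - 24 * (2 * a₄ + a₁ * a₃)) :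
    (W.baseChange ℚ_[5]).c₄ = c4 := by
  subst hW; subst hc4
  rw [WeierstrassCurve.baseChange, WeierstrassCurve.map_c₄]
  simp only [WeierstrassCurve.c₄, WeierstrassCurve.b₂, WeierstrassCurve.b₄, map_sub, map_mul, map_pow, map_add,
    map_ofNat, eq_ratCast, Rat.cast_intCast]
  push_cast; ring

/-- `c₆(W ⊗ ℚ₅) = −b₂³ + 36b₂b₄ − 216b₆` as an integer. [folklore] -/
theorem baseChange_c₆_eq {c6 : ℤ}
    (hc6 : c6 = -(a₁ ^ 2 + 4 * a₂) ^ 3 + 36 * (a₁ ^ 2 + 4 * a₂) * (2 * a₄ + a₁ * a₃) - 216 * (a₃ ^ 2 + 4 * a₆)) :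
    (W.baseChange ℚ_[5]).c₆ = c6 := by
  subst hW; subst hc6
  rw [WeierstrassCurve.baseChange, WeierstrassCurve.map_c₆]
  simp only [WeierstrassCurve.c₆, WeierstrassCurve.b₂, WeierstrassCurve.b₄, WeierstrassCurve.b₆, map_sub, map_mul,
    map_pow, map_add, map_neg, map_ofNat, eq_ratCast, Rat.cast_intCast]
  push_cast; ring

/-- **The uniformisation scale is a `5`-adic unit**: for every `‖q‖₅ < 1`, `‖uniformisationScaleSq W 5 q‖ = 1` when `c₄(W)`,
`c₆(W)` are `5`-adic units (`C² = c₆(E_q)·c₄(W)/(c₄(E_q)·c₆(W))`, `c₄(E_q) = 1 + 240 s₃(q)`, `c₆(E_q) = −1 + 504 s₅(q)` units).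
At a multiplicative prime of a minimal model `c₄, c₆` are units automatically; here it is an integer hypothesis.
[cite: SteinWuthrich2013, §4.2] -/
theorem norm_uniformisationScaleSq_eq_one_of_units {c4 c6 : ℤ}
    (hc4 : c4 = (a₁ ^ 2 + 4 * a₂) ^ 2 - 24 * (2 * a₄ + a₁ * a₃))
    (hc6 : c6 = -(a₁ ^ 2 + 4 * a₂) ^ 3 + 36 * (a₁ ^ 2 + 4 * a₂) * (2 * a₄ + a₁ * a₃) - 216 * (a₃ ^ 2 + 4 * a₆))
    (h5c4 : ¬ (5 : ℤ) ∣ c4) (h5c6 : ¬ (5 : ℤ) ∣ c6) {q : ℚ_[5]} (hq : ‖q‖ < 1) :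
    ‖uniformisationScaleSq W 5 q‖ = 1 := by
  have hq1 : ‖q‖ ≤ 1 := hq.le
  have hs3 : ‖tateS 3 q‖ < 1 := (TateCurve.norm_tateS_le hq1).trans_lt hq
  have hs5 : ‖tateS 5 q‖ < 1 := (TateCurve.norm_tateS_le hq1).trans_lt hq
  have h12 : (12 : ℚ_[5]) ≠ 0 := by norm_num
  rw [uniformisationScaleSq, TateCurve.tateCurve_c₄, TateCurve.tateCurve_c₆ h12, baseChange_c₄_eq W hW hc4,
    baseChange_c₆_eq W hW hc6, TateCurve.tateE4_eq, TateCurve.tateE6]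
  set s3 := tateS 3 q
  set s5 := tateS 5 q
  have hint : ∀ n : ℤ, ‖(n : ℚ_[5])‖ ≤ 1 := fun n => Padic.norm_int_le_one n
  have h4 : ‖(c4 : ℚ_[5])‖ = 1 := norm_intCast_eq_one_of_not_dvd h5c4
  have h6 : ‖(c6 : ℚ_[5])‖ = 1 := norm_intCast_eq_one_of_not_dvd h5c6
  have hE4 : ‖1 + 240 * s3‖ = 1 := by
    have hsub : ‖(1 + 240 * s3) - 1‖ < ‖(1 : ℚ_[5])‖ := by
      rw [add_sub_cancel_left, norm_one, norm_mul, show (240 : ℚ_[5]) = ((240 : ℤ) : ℚ_[5]) by norm_cast]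
      calc ‖((240 : ℤ) : ℚ_[5])‖ * ‖s3‖ ≤ 1 * ‖s3‖ := by gcongr; exact hint 240
        _ < 1 := by rw [one_mul]; exact hs3
    rw [Padic.norm_eq_of_norm_sub_lt_right hsub, norm_one]
  have hE6 : ‖-(1 - 504 * s5)‖ = 1 := by
    rw [norm_neg]
    have hsub : ‖(1 - 504 * s5) - 1‖ < ‖(1 : ℚ_[5])‖ := by
      rw [show (1 - 504 * s5) - 1 = -(504 * s5) by ring, norm_neg, norm_one, norm_mul,
        show (504 : ℚ_[5]) = ((504 : ℤ) : ℚ_[5]) by norm_cast]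
      calc ‖((504 : ℤ) : ℚ_[5])‖ * ‖s5‖ ≤ 1 * ‖s5‖ := by gcongr; exact hint 504
        _ < 1 := by rw [one_mul]; exact hs5
    rw [Padic.norm_eq_of_norm_sub_lt_right hsub, norm_one]
  rw [norm_div, norm_mul, norm_mul, hE6, h4, hE4, h6]; norm_num

/-- The uniformisation scale is non-zero (`5 ∤ c₄c₆`, `‖q‖₅ < 1`). [cite: SteinWuthrich2013, §4.2] -/
theorem uniformisationScaleSq_ne_zero_of_units {c4 c6 : ℤ}
    (hc4 : c4 = (a₁ ^ 2 + 4 * a₂) ^ 2 - 24 * (2 * a₄ + a₁ * a₃))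
    (hc6 : c6 = -(a₁ ^ 2 + 4 * a₂) ^ 3 + 36 * (a₁ ^ 2 + 4 * a₂) * (2 * a₄ + a₁ * a₃) - 216 * (a₃ ^ 2 + 4 * a₆))
    (h5c4 : ¬ (5 : ℤ) ∣ c4) (h5c6 : ¬ (5 : ℤ) ∣ c6) {q : ℚ_[5]} (hq : ‖q‖ < 1) :
    uniformisationScaleSq W 5 q ≠ 0 := by
  intro h
  have := norm_uniformisationScaleSq_eq_one_of_units W hW hc4 hc6 h5c4 h5c6 hq
  rw [h, norm_zero] at this
  exact zero_ne_one this

end Model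

end Summit.BirchSwinnertonDyer.Rank1Residual.X11b.RegMult.KernelCertFive
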